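import Mathlib
import HarnessLib
import Literature.Analysis.FluidPDE.SelfSimilar
import Literature.Analysis.FluidPDE.VectorCalculus
import Literature.Analysis.FluidPDE.RadialCalculus
import Literature.Analysis.FluidPDE.ClassicalSolutionGalilean
import Literature.Analysis.FluidPDE.KNSSRegularityGalilean
import Literature.Analysis.FluidPDE.LerayProfileCalculus
import Literature.Analysis.FluidPDE.ClassicalSolution
import Literature.Analysis.FluidPDE.ClassicalSolutionCalculus
import Literature.Analysis.FluidPDE.SpaceTimeCalculus
import Literature.Analysis.FluidPDE.TaoEnstrophyLocalisation
import Literature.Analysis.UnboundedOperators.HeatKernel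
import Literature.Analysis.FluidPDE.NSBoundedMildOseen
import Summits.NavierStokesRegularity.NavierStokesRegularity.Theorems.PoloidalWindowDoorPoloidalWindowRigidityWholeSpaceComparison
import Summits.NavierStokesRegularity.NavierStokesRegularity.Theorems.PoloidalWindowDoorPoloidalWindowRigidityDecayingSlopeLiouvilleBarrier
import Summits.NavierStokesRegularity.NavierStokesRegularity.Theorems.PoloidalWindowDoorPoloidalWindowRigidityDecayingSlopeLiouvilleSlab

/-!
# K2 line `slicesharp-screw`, stub L4 `stub_decayingSlopeLiouville` — file 3/4: THE KEY BOUND `|w| ≤ Ψ` ON `[t₀,t₁] × ℝ³`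
# by DYADIC TIME BLOCKS on the whole-space comparison (STUB L4a, tree `…WholeSpaceComparison.stub_wholeSpaceComparison`)

Cell ns-regularity-ideate, K2 lead nsreg-p7 (helper file, `--supports stmt-NavierStokesRegularity-19708 --as helper`).
`w(t,y) = θ(t,y) − θ(t₀,x₀) − ∫_{t₀}^t src` solves the homogeneous drift–diffusion law along `v` with
`|w(t₀,y)| ≤ ε(t₀)‖y − x₀‖`; the barrier `Ψ = ε(t₀)[(‖y−x₀‖² + 3|t₀|)^{1/2} + 4C(√(−t₀) − √(−t)) + (t−t₀)·3/√(3|t₀|)]`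
(file 1) is a super-barrier for every drift bound `A ≤ 2C/√(−t)`, which the class bound `‖v(t)‖ ≤ C/√(−t)` supplies
on each block `[s, s/4]` with `A = C/√(−s/4)`; the comparison (L4a, ns-poloidal-K2-p3 p455923) is applied block by block
(`s_n = min(t₀/4ⁿ, t₁)`, induction on `n`), the linear growth of `w` coming from the slope hypothesis and the continuity
of `ε` on the compact time interval.

WHAT THIS IS NOT: not a claim about Navier–Stokes regularity — calculus for one registered stub of the K2 line of a door route
(bears_on LADDER-NS N0, rung N0-LocalTubeDoorPoloidal).
-/

noncomputable section

set_option linter.dupNamespace false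

namespace Summit.NavierStokesRegularity.NavierStokesRegularity.Theorems.PoloidalWindowDoorPoloidalWindowRigidityDecayingSlopeLiouvilleKeyBound

open Set Function Filter Topology Metric InnerProductSpace MeasureTheory
open scoped RealInnerProductSpace Laplacian
open Literature.Analysis Literature.Analysis.FluidPDE
open Summit.NavierStokesRegularity.NavierStokesRegularity.Theorems.PoloidalWindowDoorPoloidalWindowRigidityDecayingSlopeLiouvilleBarrier
open Summit.NavierStokesRegularity.NavierStokesRegularity.Theorems.PoloidalWindowDoorPoloidalWindowRigidityDecayingSlopeLiouvilleSlab

/-! ### Part E — the key bound on `[t₀, t₁]` by dyadic blocks, and the lemma -/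

section KeyBound

variable {C : ℝ} {v : ℝ → (EuclideanSpace ℝ (Fin 3)) → (EuclideanSpace ℝ (Fin 3))} {θ : ℝ → (EuclideanSpace ℝ (Fin 3)) → ℝ} {src : ℝ → ℝ} {x₀ : (EuclideanSpace ℝ (Fin 3))} {ε : ℝ → ℝ}

/-- **The key bound.** Under the hypotheses of the stub and the whole-space comparison (L4a): for `t₀ < t₁ < 0`,
with `w(t,y) = θ(t,y) − θ(t₀,x₀) − ∫_{t₀}^t src` and the barrier
`Ψ(t,y) = ε(t₀)[(‖y−x₀‖² + 3|t₀|)^{1/2} + 4C(√(−t₀) − √(−t)) + (3/√(3|t₀|))(t − t₀)]`,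
`|w| ≤ Ψ` on `[t₀,t₁] × ℝ³` (dyadic blocks `[s, s/4]`, on which `‖v‖ ≤ C/√(−s/4) ≤ 2C/√(−t)`). -/
theorem key_bound
    (hrate : HasTypeITimeDecay C v) (hcont : ContinuousOn (uncurry v) (Iio (0:ℝ) ×ˢ univ))
    (hθ : ContDiffOn ℝ 2 (uncurry θ) (Iio (0:ℝ) ×ˢ univ))
    (heq : ∀ t < 0, ∀ x, deriv (fun τ => θ τ x) t + fderiv ℝ (θ t) x (v t x) - (Δ (θ t)) x = src t)
    (hslope : ∀ t < 0, ∀ x, |θ t x - θ t x₀| ≤ ε t * ‖x - x₀‖) (hεc : ContinuousOn ε (Iio 0))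
    {t₀ t₁ : ℝ} (ht₀₁ : t₀ < t₁) (ht₁ : t₁ < 0) :
    ∀ t ∈ Icc t₀ t₁, ∀ y : (EuclideanSpace ℝ (Fin 3)),
      |θ t y - θ t₀ x₀ - ∫ τ in t₀..t, src τ| ≤
        ε t₀ * (Real.sqrt (‖y - x₀‖ ^ 2 + 3 * (-t₀)) +
          (4 * C * (Real.sqrt (-t₀) - Real.sqrt (-t)) + 3 / Real.sqrt (3 * (-t₀)) * (t - t₀))) := by
  have ht₀ : t₀ < 0 := ht₀₁.trans ht₁
  have hnt₀ : 0 < -t₀ := neg_pos.2 ht₀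
  -- ## constants
  have hC : 0 ≤ C := by
    have h := hrate (-1) (by norm_num) 0
    rw [neg_neg, Real.sqrt_one, div_one] at h
    exact (norm_nonneg _).trans h
  set ε₀ : ℝ := ε t₀ with hε₀
  have hε₀0 : 0 ≤ ε₀ := by
    have h := hslope t₀ ht₀ (x₀ + EuclideanSpace.single 0 1)
    have hn : ‖x₀ + EuclideanSpace.single 0 (1:ℝ) - x₀‖ = 1 := by
      rw [add_sub_cancel_left, PiLp.norm_single, norm_one]
    rw [hn, mul_one] at h
    exact (abs_nonneg _).trans h
  set m : ℝ := 3 * (-t₀) with hm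
  have hm0 : 0 < m := by positivity
  set q : ℝ := 3 / Real.sqrt m with hq
  have hq0 : 0 ≤ q := by positivity
  -- ## the source is continuous on `(−∞, 0)`
  have hsrc : ContinuousOn src (Iio 0) := by
    have hv0 : ContinuousOn (fun t => v t x₀) (Iio 0) :=
      hcont.comp (continuousOn_pair x₀) fun _ ht => ⟨ht, mem_univ _⟩
    have h1 : ContinuousOn (fun t => deriv (fun τ => θ τ x₀) t + fderiv ℝ (θ t) x₀ (v t x₀) - (Δ (θ t)) x₀)
        (Iio 0) :=
      ((continuousOn_deriv_time hθ x₀).add ((continuousOn_fderiv_slice hθ x₀).clm_apply hv0)).sub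
        (continuousOn_laplacian_slice hθ x₀)
    exact h1.congr fun t ht => (heq t ht x₀).symm
  -- ## the solution `w` and its time derivative
  set w : ℝ → (EuclideanSpace ℝ (Fin 3)) → ℝ := fun t y => θ t y - θ t₀ x₀ - ∫ τ in t₀..t, src τ with hw
  set wt : ℝ → (EuclideanSpace ℝ (Fin 3)) → ℝ := fun t y => deriv (fun τ => θ τ y) t - src t with hwt
  -- ## the barrier
  set Ψ : ℝ → (EuclideanSpace ℝ (Fin 3)) → ℝ := fun t y => ε₀ * (Real.sqrt (‖y - x₀‖ ^ 2 + m) +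
    (4 * C * (Real.sqrt (-t₀) - Real.sqrt (-t)) + q * (t - t₀))) with hΨ
  set Ψt : ℝ → (EuclideanSpace ℝ (Fin 3)) → ℝ := fun t _ => ε₀ * (2 * C / Real.sqrt (-t) + q) with hΨt
  -- ## what we prove: `|w| ≤ Ψ` on `[t₀, t₁]`
  suffices H : ∀ t ∈ Icc t₀ t₁, ∀ y : (EuclideanSpace ℝ (Fin 3)), |w t y| ≤ Ψ t y by
    intro t ht y
    have := H t ht y
    simpa only [hw, hΨ, hq, hm] using this
  -- ## facts about `w` on `[t₀, t₁]`
  have hIcc : Icc t₀ t₁ ⊆ Iio 0 := fun t ht => lt_of_le_of_lt ht.2 ht₁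
  have hint_cont : ContinuousOn (fun t => ∫ τ in t₀..t, src τ) (Icc t₀ t₁) := by
    have h := intervalIntegral.continuousOn_primitive_interval (μ := volume) (f := src) (a := t₀) (b := t₁)
      ((hsrc.mono ?_).integrableOn_compact isCompact_uIcc)
    · rwa [uIcc_of_le ht₀₁.le] at h
    · rw [uIcc_of_le ht₀₁.le]; exact hIcc
  have hw_cont : ContinuousOn (uncurry w) (Icc t₀ t₁ ×ˢ univ) := by
    have h1 : ContinuousOn (uncurry θ) (Icc t₀ t₁ ×ˢ univ) :=
      hθ.continuousOn.mono (prod_mono hIcc subset_rfl)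
    have h2 : ContinuousOn (fun p : ℝ × (EuclideanSpace ℝ (Fin 3)) => ∫ τ in t₀..p.1, src τ) (Icc t₀ t₁ ×ˢ univ) :=
      hint_cont.comp continuousOn_fst fun p hp => hp.1
    exact (h1.sub continuousOn_const).sub h2
  have hw_C2 : ∀ t ∈ Icc t₀ t₁, ContDiff ℝ 2 (w t) := fun t ht =>
    ((contDiff_slice_two hθ (hIcc ht)).sub contDiff_const).sub contDiff_const
  have hw_fderiv : ∀ t ∈ Icc t₀ t₁, ∀ y, fderiv ℝ (w t) y = fderiv ℝ (θ t) y := by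
    intro t ht y
    show fderiv ℝ (fun y => θ t y - θ t₀ x₀ - ∫ τ in t₀..t, src τ) y = _
    rw [fderiv_sub_const, fderiv_sub_const]
  have hw_lap : ∀ t ∈ Icc t₀ t₁, ∀ y, (Δ (w t)) y = (Δ (θ t)) y := by
    intro t ht y
    show (Δ (fun y => θ t y - θ t₀ x₀ - ∫ τ in t₀..t, src τ)) y = _
    rw [laplacian_sub_const' ((contDiff_slice_two hθ (hIcc ht)).sub contDiff_const),
      laplacian_sub_const' (contDiff_slice_two hθ (hIcc ht))]
  have hw_fderiv_cont : ∀ y, ContinuousOn (fun τ => fderiv ℝ (w τ) y) (Icc t₀ t₁) := fun y =>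
    ((continuousOn_fderiv_slice hθ y).mono hIcc).congr fun t ht => hw_fderiv t ht y
  have hw_lap_cont : ∀ y, ContinuousOn (fun τ => (Δ (w τ)) y) (Icc t₀ t₁) := fun y =>
    ((continuousOn_laplacian_slice hθ y).mono hIcc).congr fun t ht => hw_lap t ht y
  have hw_deriv : ∀ y, ∀ t ∈ Icc t₀ t₁, HasDerivAt (fun τ => w τ y) (wt t y) t := by
    intro y t ht
    have h1 : HasDerivAt (fun τ => θ τ y) (deriv (fun τ => θ τ y) t) t := hasDerivAt_time hθ (hIcc ht) y
    have h2 : HasDerivAt (fun τ => ∫ s in t₀..τ, src s) (src t) t := by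
      refine intervalIntegral.integral_hasDerivAt_right ?_ ?_ ?_
      · exact (hsrc.mono (by rw [uIcc_of_le ht.1]; exact fun s hs => lt_of_le_of_lt hs.2 (hIcc ht))).intervalIntegrable
      · exact hsrc.stronglyMeasurableAtFilter isOpen_Iio _ (hIcc ht)
      · exact hsrc.continuousAt (Iio_mem_nhds (hIcc ht))
    have h3 := (h1.sub_const (θ t₀ x₀)).sub h2
    exact h3
  have hwt_cont : ∀ y, ContinuousOn (fun τ => wt τ y) (Icc t₀ t₁) := fun y =>
    ((continuousOn_deriv_time hθ y).mono hIcc).sub (hsrc.mono hIcc)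
  have hw_law : ∀ t ∈ Icc t₀ t₁, ∀ y, wt t y + fderiv ℝ (w t) y (v t y) - (Δ (w t)) y = 0 := by
    intro t ht y
    rw [hw_fderiv t ht y, hw_lap t ht y]
    have h := heq t (hIcc ht) y
    show deriv (fun τ => θ τ y) t - src t + fderiv ℝ (θ t) y (v t y) - (Δ (θ t)) y = 0
    linarith
  -- ## linear growth of `w` on `[t₀, t₁]`
  obtain ⟨Mg, hMg⟩ : ∃ Mg : ℝ, ∀ t ∈ Icc t₀ t₁, ∀ y : (EuclideanSpace ℝ (Fin 3)), |w t y| ≤ Mg * (1 + ‖y‖) := by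
    obtain ⟨E, hE⟩ := (isCompact_Icc (a := t₀) (b := t₁)).exists_bound_of_continuousOn (hεc.mono hIcc)
    have hγc : ContinuousOn (fun t => θ t x₀ - θ t₀ x₀ - ∫ τ in t₀..t, src τ) (Icc t₀ t₁) :=
      (((continuousOn_time hθ x₀).mono hIcc).sub continuousOn_const).sub hint_cont
    obtain ⟨G, hG⟩ := (isCompact_Icc (a := t₀) (b := t₁)).exists_bound_of_continuousOn hγc
    have hE0 : 0 ≤ E := (norm_nonneg _).trans (hE t₀ (left_mem_Icc.2 ht₀₁.le))
    have hG0 : 0 ≤ G := (norm_nonneg _).trans (hG t₀ (left_mem_Icc.2 ht₀₁.le))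
    refine ⟨E * (1 + ‖x₀‖) + G, fun t ht y => ?_⟩
    have h1 : |θ t y - θ t x₀| ≤ E * (‖y‖ + ‖x₀‖) := by
      refine (hslope t (hIcc ht) y).trans ?_
      have := hE t ht
      rw [Real.norm_eq_abs] at this
      calc ε t * ‖y - x₀‖ ≤ |ε t| * ‖y - x₀‖ := mul_le_mul_of_nonneg_right (le_abs_self _) (norm_nonneg _)
        _ ≤ E * (‖y‖ + ‖x₀‖) := mul_le_mul this (norm_sub_le _ _) (norm_nonneg _) hE0
    have h2 : |θ t x₀ - θ t₀ x₀ - ∫ τ in t₀..t, src τ| ≤ G := by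
      have := hG t ht; rwa [Real.norm_eq_abs] at this
    have h3 : w t y = (θ t y - θ t x₀) + (θ t x₀ - θ t₀ x₀ - ∫ τ in t₀..t, src τ) := by
      simp only [hw]; ring
    rw [h3]
    calc |θ t y - θ t x₀ + (θ t x₀ - θ t₀ x₀ - ∫ τ in t₀..t, src τ)|
        ≤ |θ t y - θ t x₀| + |θ t x₀ - θ t₀ x₀ - ∫ τ in t₀..t, src τ| := abs_add_le _ _
      _ ≤ E * (‖y‖ + ‖x₀‖) + G := add_le_add h1 h2
      _ ≤ (E * (1 + ‖x₀‖) + G) * (1 + ‖y‖) := by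
          nlinarith [norm_nonneg y, norm_nonneg x₀, mul_nonneg hE0 (norm_nonneg y),
            mul_nonneg hE0 (norm_nonneg x₀), mul_nonneg (mul_nonneg hE0 (norm_nonneg x₀)) (norm_nonneg y),
            mul_nonneg hG0 (norm_nonneg y)]
  -- ## facts about the barrier
  have hΨ_C2 : ∀ t, ContDiff ℝ 2 (Ψ t) := fun t => contDiff_barrier hm0 x₀
  have hΨ_cont : ContinuousOn (uncurry Ψ) (Icc t₀ t₁ ×ˢ univ) := by
    have h1 : Continuous fun p : ℝ × (EuclideanSpace ℝ (Fin 3)) => Real.sqrt (‖p.2 - x₀‖ ^ 2 + m) :=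
      Real.continuous_sqrt.comp (((continuous_snd.sub continuous_const).norm.pow 2).add continuous_const)
    have h2 : Continuous fun p : ℝ × (EuclideanSpace ℝ (Fin 3)) =>
        4 * C * (Real.sqrt (-t₀) - Real.sqrt (-p.1)) + q * (p.1 - t₀) := by
      fun_prop
    have h3 : Continuous fun p : ℝ × (EuclideanSpace ℝ (Fin 3)) => ε₀ * (Real.sqrt (‖p.2 - x₀‖ ^ 2 + m) +
        (4 * C * (Real.sqrt (-t₀) - Real.sqrt (-p.1)) + q * (p.1 - t₀))) := continuous_const.mul (h1.add h2)
    exact h3.continuousOn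
  have hΨ_deriv : ∀ y, ∀ t ∈ Icc t₀ t₁, HasDerivAt (fun τ => Ψ τ y) (Ψt t y) t := by
    intro y t ht
    have h := ((hasDerivAt_clock C q t₀ (hIcc ht)).const_add (Real.sqrt (‖y - x₀‖ ^ 2 + m))).const_mul ε₀
    exact h
  have hΨt_cont : ∀ y, ContinuousOn (fun τ => Ψt τ y) (Icc t₀ t₁) := by
    intro y
    refine ContinuousOn.mono ?_ hIcc
    have : ContinuousOn (fun τ : ℝ => ε₀ * (2 * C / Real.sqrt (-τ) + q)) (Iio 0) := by
      refine continuousOn_const.mul ((ContinuousOn.div continuousOn_const ?_ ?_).add continuousOn_const)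
      · exact (Real.continuous_sqrt.comp continuous_neg).continuousOn
      · intro τ hτ; exact (Real.sqrt_pos.2 (neg_pos.2 hτ)).ne'
    exact this
  have hΨ_fderiv_cont : ∀ y, ContinuousOn (fun τ => fderiv ℝ (Ψ τ) y) (Icc t₀ t₁) := by
    intro y
    have : ∀ τ, fderiv ℝ (Ψ τ) y = ε₀ • fderiv ℝ (fun z : (EuclideanSpace ℝ (Fin 3)) => Real.sqrt (‖z - x₀‖ ^ 2 + m)) y :=
      fun τ => fderiv_barrier_eq hm0 x₀ y
    simp_rw [this]
    exact continuousOn_const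
  have hΨ_lap_cont : ∀ y, ContinuousOn (fun τ => (Δ (Ψ τ)) y) (Icc t₀ t₁) := by
    intro y
    have : ∀ τ, (Δ (Ψ τ)) y = ε₀ * (Δ (fun z : (EuclideanSpace ℝ (Fin 3)) => Real.sqrt (‖z - x₀‖ ^ 2 + m))) y :=
      fun τ => laplacian_barrier_eq hm0 x₀ y
    simp_rw [this]
    exact continuousOn_const
  have hΨ_nonneg : ∀ t ∈ Icc t₀ t₁, ∀ y, 0 ≤ Ψ t y := by
    intro t ht y
    have h1 : 0 ≤ Real.sqrt (‖y - x₀‖ ^ 2 + m) := Real.sqrt_nonneg _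
    have h2 : Real.sqrt (-t) ≤ Real.sqrt (-t₀) := Real.sqrt_le_sqrt (by linarith [ht.1])
    have h3 : 0 ≤ q * (t - t₀) := mul_nonneg hq0 (by linarith [ht.1])
    have h4 : 0 ≤ 4 * C * (Real.sqrt (-t₀) - Real.sqrt (-t)) := by nlinarith
    exact mul_nonneg hε₀0 (by linarith)
  -- supersolution on a block where the drift bound `A` satisfies `A ≤ 2C/√(−t)`
  have hΨ_super : ∀ (A t : ℝ), t < 0 → 0 ≤ A → A ≤ 2 * C / Real.sqrt (-t) → ∀ y,
      (Δ (Ψ t)) y + A * ‖fderiv ℝ (Ψ t) y‖ ≤ Ψt t y := by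
    intro A t ht hA0 hA y
    have h1 : (Δ (Ψ t)) y ≤ ε₀ * (3 / Real.sqrt m) := laplacian_barrier_le hm0 hε₀0 x₀ y
    have h2 : ‖fderiv ℝ (Ψ t) y‖ ≤ ε₀ := norm_fderiv_barrier_le hm0 hε₀0 x₀ y
    have h3 : A * ‖fderiv ℝ (Ψ t) y‖ ≤ 2 * C / Real.sqrt (-t) * ε₀ :=
      mul_le_mul hA h2 (norm_nonneg _) (hA0.trans hA)
    show (Δ (Ψ t)) y + A * ‖fderiv ℝ (Ψ t) y‖ ≤ ε₀ * (2 * C / Real.sqrt (-t) + q)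
    rw [hq]
    nlinarith
  -- ## the bottom bound at `t₀`
  have hbot : ∀ y, |w t₀ y| ≤ Ψ t₀ y := by
    intro y
    have h1 : w t₀ y = θ t₀ y - θ t₀ x₀ := by
      simp only [hw, intervalIntegral.integral_same, sub_zero]
    have h2 : Ψ t₀ y = ε₀ * Real.sqrt (‖y - x₀‖ ^ 2 + m) := by
      simp only [hΨ, sub_self, mul_zero, add_zero]
    rw [h1, h2]
    refine (hslope t₀ ht₀ y).trans ?_
    exact mul_le_mul_of_nonneg_left (norm_le_sqrt_norm_sq_add hm0.le _) hε₀0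
  -- ## one block `[a, b]` with `t₀ ≤ a < b ≤ t₁` and `−a ≤ 4(−b)`
  have hblock : ∀ a b : ℝ, t₀ ≤ a → a < b → b ≤ t₁ → -a ≤ 4 * (-b) →
      (∀ y, |w a y| ≤ Ψ a y) → ∀ t ∈ Icc a b, ∀ y, |w t y| ≤ Ψ t y := by
    intro a b ha hab hb hab4 hbota
    have hb0 : b < 0 := lt_of_le_of_lt hb ht₁
    have hnb : 0 < -b := neg_pos.2 hb0
    have hsub : Icc a b ⊆ Icc t₀ t₁ := Icc_subset_Icc ha hb
    set A : ℝ := C / Real.sqrt (-b) with hA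
    have hA0 : 0 ≤ A := div_nonneg hC (Real.sqrt_nonneg _)
    -- drift bound on the block
    have hdrift : ∀ t ∈ Icc a b, ∀ y, ‖v t y‖ ≤ A := by
      intro t ht y
      have ht0 : t < 0 := lt_of_le_of_lt ht.2 hb0
      refine (hrate t ht0 y).trans ?_
      rw [hA]
      exact div_le_div_of_nonneg_left hC (Real.sqrt_pos.2 hnb) (Real.sqrt_le_sqrt (by linarith [ht.2]))
    -- `A ≤ 2C/√(−t)` on the block
    have hA2 : ∀ t ∈ Icc a b, A ≤ 2 * C / Real.sqrt (-t) := by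
      intro t ht
      have ht0 : 0 < -t := by linarith [ht.2]
      have h1 : Real.sqrt (-t) ≤ 2 * Real.sqrt (-b) := by
        rw [show (2:ℝ) = Real.sqrt 4 by rw [show (4:ℝ) = 2^2 by norm_num, Real.sqrt_sq (by norm_num : (0:ℝ) ≤ 2)],
          ← Real.sqrt_mul (by norm_num)]
        exact Real.sqrt_le_sqrt (by linarith [ht.1])
      rw [hA, div_le_div_iff₀ (Real.sqrt_pos.2 hnb) (Real.sqrt_pos.2 ht0)]
      nlinarith [Real.sqrt_nonneg (-b), hC]
    exact Summit.NavierStokesRegularity.NavierStokesRegularity.Theorems.PoloidalWindowDoorPoloidalWindowRigidityWholeSpaceComparison.stub_wholeSpaceComparison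
      v A Mg w Ψ Ψt a b hab
      (hcont.mono (prod_mono (fun t ht => lt_of_le_of_lt ht.2 hb0) subset_rfl)) hdrift wt
      (hw_cont.mono (prod_mono hsub subset_rfl)) (fun t ht => hw_C2 t (hsub ht))
      (fun y => (hw_fderiv_cont y).mono hsub) (fun y => (hw_lap_cont y).mono hsub)
      (fun y t ht => hw_deriv y t (hsub ht)) (fun y => (hwt_cont y).mono hsub)
      (fun t ht y => hw_law t (hsub ht) y) (fun t ht y => hMg t (hsub ht) y)
      hΨ_C2 (hΨ_cont.mono (prod_mono hsub subset_rfl)) (fun y t ht => hΨ_deriv y t (hsub ht))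
      (fun y => (hΨt_cont y).mono hsub) (fun y => (hΨ_fderiv_cont y).mono hsub)
      (fun y => (hΨ_lap_cont y).mono hsub)
      (fun t ht y => hΨ_super A t (lt_of_le_of_lt ht.2 hb0) hA0 (hA2 t ht) y)
      (fun t ht y => hΨ_nonneg t (hsub ht) y) hbota
  -- ## dyadic induction
  set s : ℕ → ℝ := fun n => min (t₀ / 4 ^ n) t₁ with hs
  have hs_ge : ∀ n, t₀ ≤ s n := by
    intro n
    refine le_min ?_ ht₀₁.le
    have h4 : (1:ℝ) ≤ 4 ^ n := one_le_pow₀ (by norm_num)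
    rw [le_div_iff₀ (by positivity)]
    nlinarith
  have hs_le : ∀ n, s n ≤ t₁ := fun n => min_le_right _ _
  have hP : ∀ n : ℕ, ∀ t ∈ Icc t₀ (s n), ∀ y, |w t y| ≤ Ψ t y := by
    intro n
    induction n with
    | zero =>
      intro t ht y
      have hs0 : s 0 = t₀ := by simp [hs, min_eq_left ht₀₁.le]
      rw [hs0] at ht
      have : t = t₀ := le_antisymm ht.2 ht.1
      rw [this]; exact hbot y
    | succ n ih =>
      intro t ht y
      by_cases hcase : s n = t₁
      · -- trivial block
        have : s (n + 1) = t₁ := by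
          refine le_antisymm (hs_le _) ?_
          have h1 : t₁ ≤ t₀ / 4 ^ n := by
            have := min_le_left (t₀ / 4 ^ n) t₁
            rw [← hcase]; exact this
          refine le_min ?_ le_rfl
          have h2 : t₀ / 4 ^ n ≤ t₀ / 4 ^ (n + 1) := by
            rw [div_le_div_iff₀ (by positivity) (by positivity), pow_succ]
            nlinarith [pow_pos (by norm_num : (0:ℝ) < 4) n]
          exact h1.trans h2
        rw [this] at ht
        rw [hcase] at ih
        exact ih t ht y
      · -- genuine block `[s n, s (n+1)]`
        have hsn_lt : s n < t₁ := lt_of_le_of_ne (hs_le n) hcase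
        have hsn_eq : s n = t₀ / 4 ^ n := by
          rcases min_choice (t₀ / 4 ^ n) t₁ with h | h
          · exact h
          · exact absurd h hcase
        have hlt : s n < s (n + 1) := by
          refine lt_min ?_ hsn_lt
          rw [hsn_eq, div_lt_div_iff₀ (by positivity) (by positivity), pow_succ]
          nlinarith [pow_pos (by norm_num : (0:ℝ) < 4) n]
        have h4 : -(s n) ≤ 4 * (-(s (n + 1))) := by
          have h1 : s (n + 1) ≤ t₀ / 4 ^ (n + 1) := min_le_left _ _
          rw [hsn_eq]
          have h2 : t₀ / 4 ^ n = 4 * (t₀ / 4 ^ (n + 1)) := by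
            rw [pow_succ]; field_simp
          rw [h2]; linarith
        by_cases htn : t ≤ s n
        · exact ih t ⟨ht.1, htn⟩ y
        · push Not at htn
          exact hblock (s n) (s (n + 1)) (hs_ge n) hlt (hs_le _) h4
            (fun y => ih (s n) ⟨hs_ge n, le_rfl⟩ y) t ⟨htn.le, ht.2⟩ y
  -- ## reach `t₁`
  obtain ⟨N, hN⟩ : ∃ N : ℕ, s N = t₁ := by
    obtain ⟨N, hN⟩ := pow_unbounded_of_one_lt (t₀ / t₁) (by norm_num : (1:ℝ) < 4)
    refine ⟨N, min_eq_right ?_⟩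
    have ht₁ne : t₁ ≠ 0 := ht₁.ne
    have h1 : t₀ / t₁ * t₁ ≥ 4 ^ N * t₁ := by nlinarith
    have h2 : t₀ / t₁ * t₁ = t₀ := div_mul_cancel₀ t₀ ht₁ne
    rw [h2] at h1
    rw [le_div_iff₀ (by positivity)]
    linarith
  intro t ht y
  exact hP N t (by rw [hN]; exact ht) y

end KeyBound

end Summit.NavierStokesRegularity.NavierStokesRegularity.Theorems.PoloidalWindowDoorPoloidalWindowRigidityDecayingSlopeLiouvilleKeyBound

end
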